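import Mathlib

/-!
# Route BarrierLever — item `PartitionMinorsHitByVP` (stmt-ValiantsHypothesis-19717), line `hidden-states`:
# THE FOUR-MOVER CHAIN IDENTITY (pure algebra, budget three) — toolkit for `…SecondShellChainFour`

Helper file (`--supports stmt-ValiantsHypothesis-19717`; cell valiant-natproofs, 𝒟-side door (c), registered line
`Cruxes/PartitionMinorsHitByVP/Lines/hidden_states.lean` v8; prover seat val-np-p6 gen 18).  Closes NO item; definition-free.

THE BUDGET-THREE EXPANSION for a CHAIN of four movers `e → c → b → a` (`b` reads `a` with weight `σ₁`, `c` reads `b` with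
`σ₂`, `e` reads `c` with `σ₃`; constants `a₀, b₀, c₀, e₀` = what the movers read inside the inert block; every read exit `d`
carries symbolic weights `α_d, β_d, γ_d, ε_d`).  On a column meeting at most three free nodes the product `Y_a Y_b Y_c Y_e` is an
explicit combination of the products `Y_S · ∏_{d ∈ U} n_d`, `|S| + |U| ≤ 3` (★ `chain₄_column_identity`; found by generic-weight
elimination, lab/gen_chain4.py + verify_chain4.py of this seat, 32 budget cases, checked here by `ring`).  The pair and triple
terms are written as sums over ORDERED tuples of distinct exits with integer kernels.  THE TOP COEFFICIENTS (the only ones that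
can sit on a missing row in a cross minor): pure triples `−4σ₁σ₂σ₃ Σ_sym β_d α_{d'} α_{d''}` — TWO exits of the bottom mover and
ONE of the second mover, never three bottom exits —, `{d,d',a}: 2σ₂σ₃β_dβ_{d'} + 2σ₁σ₂σ₃(β_dα_{d'} + α_dβ_{d'})`,
`{d,d',b}: 2σ₁σ₂σ₃α_dα_{d'}`, `{d,d',c}: 0`, `{d,d',e}: 2σ₁σ₂α_dα_{d'}`.  (Three movers: `…SecondShellChainIdentity`, pure pairs
`2στα_dα_{d'}`; five movers, budget four: `8σ₁σ₂σ₃σ₄ Σ_sym γβαα` — lab/chaink_top.py.)  Also the bookkeeping of nested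
erase-sums over explicit small sets (`sum_erase₂_pair/_triple`, `sum_erase₃_triple`, …).

HONEST LABEL: conjecture-column toolkit (second shell, every `t, h`); 19717 stays OPEN; nothing on crux 14610 or VP ≠ VNP.
-/

set_option linter.dupNamespace false

namespace Summit.ValiantsHypothesis.ValiantsHypothesis.Theorems.BarrierLever.HiddenStates

open Finset

noncomputable section

namespace SecondShell

variable {β : Type*} [DecidableEq β]

/-! ## Nested erase-sums over explicit small sets -/
/-- inner erase-sum as a difference. -/
theorem sum_erase₂_eq (s : Finset β) (f : β → β → ℂ) :
    ∑ d ∈ s, ∑ d' ∈ s.erase d, f d d' = ∑ d ∈ s, ((∑ d' ∈ s, f d d') - f d d) :=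
  Finset.sum_congr rfl fun _ hd => Finset.sum_erase_eq_sub hd

/-- double erase-sum as differences of full sums. -/
theorem sum_erase₃_eq (s : Finset β) (f : β → β → β → ℂ) :
    ∑ d ∈ s, ∑ d' ∈ s.erase d, ∑ d'' ∈ (s.erase d).erase d', f d d' d'' =
      ∑ d ∈ s, ((∑ d' ∈ s, ((∑ d'' ∈ s, f d d' d'') - f d d' d - f d d' d'))
        - ((∑ d'' ∈ s, f d d d'') - f d d d - f d d d)) := by
  refine Finset.sum_congr rfl fun d hd => ?_
  have h1 : ∀ d' ∈ s.erase d, ∑ d'' ∈ (s.erase d).erase d', f d d' d'' = (∑ d'' ∈ s, f d d' d'') - f d d' d - f d d' d' := by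
    intro d' hd'
    rw [Finset.sum_erase_eq_sub hd', Finset.sum_erase_eq_sub hd]
  rw [Finset.sum_congr rfl h1, Finset.sum_erase_eq_sub hd]

/-- nested erase-sum over a pair: the two ordered pairs. -/
theorem sum_erase₂_pair {a b : β} (h : a ≠ b) (f : β → β → ℂ) :
    ∑ d ∈ ({a, b} : Finset β), ∑ d' ∈ ({a, b} : Finset β).erase d, f d d' = f a b + f b a := by
  rw [sum_erase₂_eq, Finset.sum_pair h, Finset.sum_pair h, Finset.sum_pair h]; ring

/-- nested erase-sum over a triple: the six ordered pairs. -/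
theorem sum_erase₂_triple {a b c : β} (hab : a ≠ b) (hac : a ≠ c) (hbc : b ≠ c) (f : β → β → ℂ) :
    ∑ d ∈ ({a, b, c} : Finset β), ∑ d' ∈ ({a, b, c} : Finset β).erase d, f d d' =
      f a b + f a c + f b a + f b c + f c a + f c b := by
  have h3 : ∀ g : β → ℂ, ∑ d ∈ ({a, b, c} : Finset β), g d = g a + g b + g c := by
    intro g; rw [Finset.sum_insert (by simp [hab, hac]), Finset.sum_pair hbc]; ring
  rw [sum_erase₂_eq, h3, h3, h3, h3]; ring

/-- double nested erase-sum over a triple: the six orderings. -/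
theorem sum_erase₃_triple {a b c : β} (hab : a ≠ b) (hac : a ≠ c) (hbc : b ≠ c) (f : β → β → β → ℂ) :
    ∑ d ∈ ({a, b, c} : Finset β), ∑ d' ∈ ({a, b, c} : Finset β).erase d,
      ∑ d'' ∈ (({a, b, c} : Finset β).erase d).erase d', f d d' d'' =
      f a b c + f a c b + f b a c + f b c a + f c a b + f c b a := by
  have h3 : ∀ g : β → ℂ, ∑ d ∈ ({a, b, c} : Finset β), g d = g a + g b + g c := by
    intro g; rw [Finset.sum_insert (by simp [hab, hac]), Finset.sum_pair hbc]; ring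
  rw [sum_erase₃_eq, h3]
  simp only [h3]
  ring

/-- a double nested erase-sum over at most two elements is empty. -/
theorem sum_erase₃_le_two (s : Finset β) (hs : s.card ≤ 2) (f : β → β → β → ℂ) :
    ∑ d ∈ s, ∑ d' ∈ s.erase d, ∑ d'' ∈ (s.erase d).erase d', f d d' d'' = 0 := by
  refine Finset.sum_eq_zero fun d hd => Finset.sum_eq_zero fun d' hd' => ?_
  have h1 : ((s.erase d).erase d').card = 0 := by
    rw [Finset.card_erase_of_mem hd', Finset.card_erase_of_mem hd]; omega
  rw [Finset.card_eq_zero.1 h1, Finset.sum_empty]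

/-- a nested erase-sum over a singleton is empty. -/
theorem sum_erase₂_singleton (a : β) (f : β → β → ℂ) :
    ∑ d ∈ ({a} : Finset β), ∑ d' ∈ ({a} : Finset β).erase d, f d d' = 0 := by
  rw [sum_erase₂_eq, Finset.sum_singleton, Finset.sum_singleton, sub_self]

/-! ## ★ The four-mover chain identity on a budget-three column -/

/-- ★ the budget-three expansion of `Y_a Y_b Y_c Y_e` for a chain `e → c → b → a` with symbolic exit weights: on a column meeting at
most three of the free nodes (movers with indicators `n_•`, read exits `JD`), `Y_a = n_a + a₀ + Σ α`, `Y_b = n_b + σ₁ n_a + b₀ + Σ β`,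
`Y_c = n_c + σ₂ n_b + c₀ + Σ γ`, `Y_e = n_e + σ₃ n_c + e₀ + Σ ε`; pair and triple terms are sums over ordered tuples of distinct exits. -/
theorem chain₄_column_identity {β : Type*} [DecidableEq β] (JD : Finset β) (αw βw γw εw : β → ℂ)
    (a₀ b₀ c₀ e₀ σ₁ σ₂ σ₃ : ℂ) (na nb nc ne : ℕ) (hna : na = 0 ∨ na = 1) (hnb : nb = 0 ∨ nb = 1)
    (hnc : nc = 0 ∨ nc = 1) (hne : ne = 0 ∨ ne = 1) (hbudget : JD.card + na + nb + nc + ne ≤ 3) (Ya Yb Yc Ye : ℂ)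
    (hYa : Ya = na + a₀ + ∑ d ∈ JD, αw d) (hYb : Yb = nb + σ₁ * na + b₀ + ∑ d ∈ JD, βw d)
    (hYc : Yc = nc + σ₂ * nb + c₀ + ∑ d ∈ JD, γw d) (hYe : Ye = ne + σ₃ * nc + e₀ + ∑ d ∈ JD, εw d) :
    Ya * Yb * Yc * Ye =
      ((-(a₀ * b₀ * c₀ * e₀) - σ₃ * a₀ * b₀ * c₀ - σ₂ * a₀ * b₀ * e₀ - σ₂ * σ₃ * a₀ * b₀ - σ₁ * a₀ * c₀ * e₀
            - σ₁ * σ₃ * a₀ * c₀ - σ₁ * σ₂ * a₀ * e₀ - σ₁ * σ₂ * σ₃ * a₀)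
        + (b₀ * c₀ * e₀ + σ₃ * b₀ * c₀ + σ₂ * b₀ * e₀ + σ₂ * σ₃ * b₀ + σ₁ * c₀ * e₀ + σ₁ * σ₃ * c₀ + σ₁ * σ₂ * e₀
            + σ₁ * σ₂ * σ₃) * (Ya)
        + (a₀ * c₀ * e₀ + σ₃ * a₀ * c₀ + σ₂ * a₀ * e₀ + σ₂ * σ₃ * a₀) * (Yb)
        + (a₀ * b₀ * e₀ + σ₃ * a₀ * b₀ + σ₁ * a₀ * e₀ + σ₁ * σ₃ * a₀) * (Yc)
        + (a₀ * b₀ * c₀ + σ₂ * a₀ * b₀ + σ₁ * a₀ * c₀ + σ₁ * σ₂ * a₀) * (Ye)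
        + (-(c₀ * e₀) - σ₃ * c₀ - σ₂ * e₀ - σ₂ * σ₃) * (Ya * Yb)
        + (-(b₀ * e₀) - σ₃ * b₀ - σ₁ * e₀ - σ₁ * σ₃) * (Ya * Yc)
        + (-(b₀ * c₀) - σ₂ * b₀ - σ₁ * c₀ - σ₁ * σ₂) * (Ya * Ye)
        + (-(a₀ * e₀) - σ₃ * a₀) * (Yb * Yc)
        + (-(a₀ * c₀) - σ₂ * a₀) * (Yb * Ye)
        + (-(a₀ * b₀) - σ₁ * a₀) * (Yc * Ye)
        + (e₀ + σ₃) * (Ya * Yb * Yc)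
        + (c₀ + σ₂) * (Ya * Yb * Ye)
        + (b₀ + σ₁) * (Ya * Yc * Ye)
        + (a₀) * (Yb * Yc * Ye))
      + ∑ d ∈ JD, ((3 * αw d * βw d * γw d * εw d + 2 * e₀ * αw d * βw d * γw d + 2 * c₀ * αw d * βw d * εw d
            + c₀ * e₀ * αw d * βw d + 2 * b₀ * αw d * γw d * εw d + b₀ * e₀ * αw d * γw d + b₀ * c₀ * αw d * εw d
            + 2 * a₀ * βw d * γw d * εw d + a₀ * e₀ * βw d * γw d + a₀ * c₀ * βw d * εw d + a₀ * b₀ * γw d * εw d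
            + σ₃ * αw d * βw d * γw d + σ₃ * c₀ * αw d * βw d - σ₃ * a₀ * b₀ * γw d + σ₂ * αw d * βw d * εw d
            + σ₂ * b₀ * αw d * εw d - σ₂ * a₀ * e₀ * βw d - σ₂ * σ₃ * αw d * βw d ^ 2 - σ₂ * σ₃ * b₀ * αw d * βw d
            - σ₂ * σ₃ * a₀ * βw d - σ₂ * σ₃ * a₀ * βw d ^ 2 - σ₂ * σ₃ * a₀ * b₀ * βw d + σ₁ * αw d * γw d * εw d
            - σ₁ * c₀ * e₀ * αw d + σ₁ * a₀ * γw d * εw d - σ₁ * σ₃ * αw d * γw d - σ₁ * σ₃ * c₀ * αw d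
            - σ₁ * σ₃ * a₀ * γw d - σ₁ * σ₂ * αw d ^ 2 * εw d - σ₁ * σ₂ * e₀ * αw d - σ₁ * σ₂ * e₀ * αw d ^ 2
            - σ₁ * σ₂ * a₀ * αw d * εw d - σ₁ * σ₂ * a₀ * e₀ * αw d - σ₁ * σ₂ * σ₃ * αw d - σ₁ * σ₂ * σ₃ * αw d * βw d
            - σ₁ * σ₂ * σ₃ * αw d ^ 2 - σ₁ * σ₂ * σ₃ * αw d ^ 2 * βw d - σ₁ * σ₂ * σ₃ * b₀ * αw d ^ 2
            - σ₁ * σ₂ * σ₃ * a₀ * βw d - σ₁ * σ₂ * σ₃ * a₀ * αw d - σ₁ * σ₂ * σ₃ * a₀ * αw d * βw d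
            - σ₁ * σ₂ * σ₃ * a₀ * b₀ * αw d - σ₁ ^ 2 * σ₂ * σ₃ * αw d ^ 2 - σ₁ ^ 2 * σ₂ * σ₃ * a₀ * αw d)
        + (-(2 * βw d * γw d * εw d) - e₀ * βw d * γw d - c₀ * βw d * εw d - b₀ * γw d * εw d + σ₃ * b₀ * γw d
            + σ₂ * e₀ * βw d + σ₂ * σ₃ * βw d + σ₂ * σ₃ * βw d ^ 2 + σ₂ * σ₃ * b₀ * βw d - σ₁ * γw d * εw d
            + σ₁ * σ₃ * γw d + σ₁ * σ₂ * αw d * εw d + σ₁ * σ₂ * e₀ * αw d + σ₁ * σ₂ * σ₃ * βw d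
            + σ₁ * σ₂ * σ₃ * αw d + σ₁ * σ₂ * σ₃ * αw d * βw d + σ₁ * σ₂ * σ₃ * b₀ * αw d + σ₁ ^ 2 * σ₂ * σ₃ * αw d) * (Ya)
        + (-(2 * αw d * γw d * εw d) - e₀ * αw d * γw d - c₀ * αw d * εw d - a₀ * γw d * εw d + σ₃ * a₀ * γw d
            - σ₂ * αw d * εw d + σ₂ * σ₃ * αw d * βw d + σ₂ * σ₃ * a₀ * βw d + σ₁ * σ₂ * σ₃ * αw d ^ 2
            + σ₁ * σ₂ * σ₃ * a₀ * αw d) * (Yb)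
        + (-(2 * αw d * βw d * εw d) - e₀ * αw d * βw d - b₀ * αw d * εw d - a₀ * βw d * εw d - σ₃ * αw d * βw d
            + σ₁ * e₀ * αw d + σ₁ * σ₃ * αw d) * (Yc)
        + (-(2 * αw d * βw d * γw d) - c₀ * αw d * βw d - b₀ * αw d * γw d - a₀ * βw d * γw d + σ₂ * a₀ * βw d
            + σ₁ * c₀ * αw d + σ₁ * σ₂ * αw d + σ₁ * σ₂ * αw d ^ 2 + σ₁ * σ₂ * a₀ * αw d) * (Ye)
        + (γw d * εw d - σ₃ * γw d - σ₂ * σ₃ * βw d - σ₁ * σ₂ * σ₃ * αw d) * (Ya * Yb)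
        + (βw d * εw d) * (Ya * Yc)
        + (βw d * γw d - σ₂ * βw d - σ₁ * σ₂ * αw d) * (Ya * Ye)
        + (αw d * εw d) * (Yb * Yc)
        + (αw d * γw d) * (Yb * Ye)
        + (αw d * βw d - σ₁ * αw d) * (Yc * Ye))
      + ∑ d ∈ JD, ∑ d' ∈ JD.erase d, ((-(γw d * εw d * αw d' * βw d') - βw d * εw d * αw d' * γw d'
            - βw d * γw d * αw d' * εw d' + σ₃ * γw d * αw d' * βw d' + σ₂ * βw d * αw d' * εw d'
            - σ₂ * σ₃ * βw d * αw d' * βw d' - σ₂ * σ₃ * a₀ * βw d * βw d' + σ₁ * γw d * εw d * αw d'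
            - σ₁ * σ₃ * γw d * αw d' - σ₁ * σ₂ * αw d * αw d' * εw d' - σ₁ * σ₂ * e₀ * αw d * αw d'
            - σ₁ * σ₂ * σ₃ * βw d * αw d' - 2 * σ₁ * σ₂ * σ₃ * βw d * αw d' ^ 2 - σ₁ * σ₂ * σ₃ * αw d * αw d'
            - 3 * σ₁ * σ₂ * σ₃ * αw d * αw d' * βw d' - σ₁ * σ₂ * σ₃ * b₀ * αw d * αw d'
            - 2 * σ₁ * σ₂ * σ₃ * a₀ * βw d * αw d' - σ₁ ^ 2 * σ₂ * σ₃ * αw d * αw d')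
        + (σ₂ * σ₃ * βw d * βw d' + 2 * σ₁ * σ₂ * σ₃ * βw d * αw d') * (Ya)
        + (σ₁ * σ₂ * σ₃ * αw d * αw d') * (Yb)
        + (σ₁ * σ₂ * αw d * αw d') * (Ye))
      + ∑ d ∈ JD, ∑ d' ∈ JD.erase d, ∑ d'' ∈ (JD.erase d).erase d', (-(2 * σ₁ * σ₂ * σ₃ * βw d * αw d' * αw d'')) := by
  have h01 : ∀ n : ℕ, (n = 0 ∨ n = 1) → n ≤ 1 := by rintro n (rfl | rfl) <;> omega
  rcases Nat.lt_or_ge JD.card 1 with h0 | h1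
  · have hJD : JD = ∅ := Finset.card_eq_zero.1 (show JD.card = 0 by omega)
    subst hJD
    simp only [Finset.sum_empty, add_zero] at hYa hYb hYc hYe ⊢
    subst hYa hYb hYc hYe
    rcases hna with rfl | rfl <;> rcases hnb with rfl | rfl <;> rcases hnc with rfl | rfl <;> rcases hne with rfl | rfl <;>
      first | (exfalso; omega) | (push_cast; ring)
  rcases Nat.lt_or_ge JD.card 2 with h1' | h2
  · obtain ⟨d, hJD⟩ := Finset.card_eq_one.1 (show JD.card = 1 by omega)
    subst hJD
    rw [Finset.card_singleton] at hbudget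
    rw [sum_erase₂_singleton, sum_erase₃_le_two _ (by simp), add_zero, add_zero]
    simp only [Finset.sum_singleton] at hYa hYb hYc hYe ⊢
    subst hYa hYb hYc hYe
    rcases hna with rfl | rfl <;> rcases hnb with rfl | rfl <;> rcases hnc with rfl | rfl <;> rcases hne with rfl | rfl <;>
      first | (exfalso; omega) | (push_cast; ring)
  rcases Nat.lt_or_ge JD.card 3 with h2' | h3
  · obtain ⟨d, d', hdd, hJD⟩ := Finset.card_eq_two.1 (show JD.card = 2 by omega)
    subst hJD
    rw [Finset.card_pair hdd] at hbudget
    rw [sum_erase₂_pair hdd, sum_erase₃_le_two _ (by rw [Finset.card_pair hdd]), add_zero]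
    simp only [Finset.sum_pair hdd] at hYa hYb hYc hYe ⊢
    subst hYa hYb hYc hYe
    rcases hna with rfl | rfl <;> rcases hnb with rfl | rfl <;> rcases hnc with rfl | rfl <;> rcases hne with rfl | rfl <;>
      first | (exfalso; omega) | (push_cast; ring)
  · obtain ⟨d, d', d'', hdd', hdd'', hd'd'', hJD⟩ := Finset.card_eq_three.1 (show JD.card = 3 by omega)
    subst hJD
    have hc3 : ({d, d', d''} : Finset β).card = 3 := by
      rw [Finset.card_insert_of_notMem (by simp [hdd', hdd'']), Finset.card_pair hd'd'']
    rw [hc3] at hbudget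
    obtain ⟨rfl, rfl, rfl, rfl⟩ : na = 0 ∧ nb = 0 ∧ nc = 0 ∧ ne = 0 := by omega
    have h3 : ∀ g : β → ℂ, ∑ x ∈ ({d, d', d''} : Finset β), g x = g d + g d' + g d'' := by
      intro g; rw [Finset.sum_insert (by simp [hdd', hdd'']), Finset.sum_pair hd'd'']; ring
    rw [sum_erase₂_triple hdd' hdd'' hd'd'', sum_erase₃_triple hdd' hdd'' hd'd'', h3]
    rw [h3] at hYa hYb hYc hYe
    subst hYa hYb hYc hYe
    push_cast; ring

end SecondShell

end

end Summit.ValiantsHypothesis.ValiantsHypothesis.Theorems.BarrierLever.HiddenStates
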